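import Literature.NumberTheory.Automorphic.ArchKirillovNullSpaceGL2
import Literature.NumberTheory.Automorphic.ArchGardingFiniteDimStable
import Literature.NumberTheory.Automorphic.ArchKFiniteGardingDensity
import Literature.NumberTheory.Automorphic.ArchKTypeDescentGL2Complex
import Literature.NumberTheory.Automorphic.ArchWeightIntegrality
import HarnessLib

/-!
# Selection of the base vector of the archimedean Hecke test vector of `GL₂(K_∞)`: a `K_∞`-finite joint
# weight vector, highest at the complex places, with non-vanishing Kirillov function
# (Jacquet–Langlands (1970), §5 (Thm. 5.13, 5.15), §6 (Thm. 6.4))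

Topic `NumberTheory/Automorphic`; namespace `Literature.NumberTheory.Automorphic`. Theorems only (no
definition, no named fact, no instance). Let `τ` be an irreducible unitary strongly continuous representation
of `G_∞ = GL₂(K_∞)` on a Hilbert space `E`, `ℓ ≠ 0` a continuous `ψ_∞`-Whittaker functional on its Gårding
space `𝒢` and `S_ℓ` the null space of the Kirillov map (`ArchKirillovNullSpaceGL2`). This file produces the
vector on which the archimedean Hecke test vector of Jacquet–Langlands is built:

* `exists_jointWeightVector_highest_of_stable` — the linear-algebra core of
  `ArchKTypeWeightVector.exists_jointWeightVector_highest`, for an arbitrary non-zero finite-dimensional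
  subspace `V ⊆ 𝒢` stable under the letters `τ(W_w)` (`w` real), `τ(T_w)`, `τ(A_w)`, `τ(B_w)` (`w` complex):
  `V` contains a non-zero joint eigenvector of the `τ(W_w)`, `τ(T_w)` killed by the raising operators
  `τ(A_w) - i τ(B_w)`.
* `exists_baseVector` — **there is a `K_∞`-finite Gårding vector `x ∉ S_ℓ` which is a joint weight vector with
  integral weights `τ(W_w) x = ik_w x` (`k_w ∈ ℤ`), `τ(T_w) x = im_w x` (`m_w ∈ ℕ`), highest at every complex
  place (`E_w x = 0`, `F_w^{m_w+1} x = 0`, `F_w^j x ≠ 0` for `j ≤ m_w`)**, lying in a finite-dimensional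
  `K_∞`-stable `V ⊆ 𝒢`. Proof: a `K_∞`-finite Gårding `e` with `ℓ(e) ≠ 0` (`exists_kFinite_apply_ne_zero`),
  `V` the span of its `K_∞`-translates, `U = S_ℓ ∩ V`; the subspace `V₁ = V ∩ U^⊥` is non-zero (`e - P_U e`),
  stable under the four families of letters (`S_ℓ` is `U(𝔤)`-stable, `gardingEnd_mem_kirillovNull_of_isUnitary`,
  and the letters are skew-symmetric, `gardingEnd_mem_orthogonal`) and meets `S_ℓ` only in `0`; apply the
  first theorem in `V₁` and read off the integrality of the weights (`ArchWeightIntegrality`,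
  `ArchKTypeDescentGL2Complex.exists_nat_weight_of_highest`).

## References

* H. Jacquet, R. P. Langlands, *Automorphic Forms on GL(2)*, LNM 114 (1970), §5 (Lemma 5.6, Thm. 5.13, 5.15),
  §6 (Thm. 6.4). [JacquetLanglands1970]
* A. W. Knapp, *Representation Theory of Semisimple Groups*, Princeton 1986, Ch. VIII §2–§3. [Knapp1986]
-/

noncomputable section

open MeasureTheory Measure NumberField NumberField.InfinitePlace NumberField.mixedEmbedding IsDedekindDomain Set Filter
open scoped MatrixGroups Topology Classical InnerProductSpace

namespace Literature.NumberTheory.Automorphic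

variable {K : Type} [Field K] [NumberField K]

-- as in `ArchGardingWhittaker`
set_option backward.isDefEq.respectTransparency false

/-! ### 1. Joint weight vectors in a letter-stable finite-dimensional subspace -/

section Stable

variable {hcpt : isCompact_glFiniteIntegralLevel 2 K}
  {E : Type*} [NormedAddCommGroup E] [NormedSpace ℂ E] [CompleteSpace E]
  {τ : ContRepresentation ℂ (AutomorphyDatum.gl 2 K hcpt).arch.carrier E}
  (hτ : τ.IsStronglyContinuous)

local notation "D" => gardingEnd (hcpt := hcpt) (τ := τ) hτ
local notation "W[" w "]" => (Matrix.single (0 : Fin 2) (1 : Fin 2) ((Pi.single w 1, 0) : mixedSpace K) -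
  Matrix.single (1 : Fin 2) (0 : Fin 2) ((Pi.single w 1, 0) : mixedSpace K))
local notation "T[" w "]" => (Matrix.single (0 : Fin 2) (0 : Fin 2) ((0, Pi.single w Complex.I) : mixedSpace K) -
  Matrix.single (1 : Fin 2) (1 : Fin 2) ((0, Pi.single w Complex.I) : mixedSpace K))
local notation "A[" w "]" => (Matrix.single (0 : Fin 2) (1 : Fin 2) ((0, Pi.single w 1) : mixedSpace K) -
  Matrix.single (1 : Fin 2) (0 : Fin 2) ((0, Pi.single w 1) : mixedSpace K))
local notation "B[" w "]" => (Matrix.single (0 : Fin 2) (1 : Fin 2) ((0, Pi.single w Complex.I) : mixedSpace K) +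
  Matrix.single (1 : Fin 2) (0 : Fin 2) ((0, Pi.single w Complex.I) : mixedSpace K))

/-- **Joint weight vectors, highest at the complex places, in a letter-stable subspace** (the linear algebra
of `exists_jointWeightVector_highest`): a non-zero finite-dimensional `V ⊆ 𝒢` stable under the `τ(W_w)`,
`τ(T_w)`, `τ(A_w)`, `τ(B_w)` contains a non-zero common eigenvector of the commuting family `τ(W_w)`, `τ(T_w)`
killed by every raising operator `τ(A_w) - iτ(B_w)` (minimise the number of complex places at which the
vector is not highest; raising strings terminate in finite dimensions).
[cite: JacquetLanglands1970, §5–§6] -/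
theorem exists_jointWeightVector_highest_of_stable {V : Submodule ℂ (archGardingSpace hcpt τ)} [FiniteDimensional ℂ V]
    (hV0 : ∃ v ∈ V, v ≠ 0)
    (hWV : ∀ w : {w : InfinitePlace K // IsReal w}, ∀ v ∈ V, D W[w] v ∈ V)
    (hTV : ∀ w : {w : InfinitePlace K // IsComplex w}, ∀ v ∈ V, D T[w] v ∈ V)
    (hAV : ∀ w : {w : InfinitePlace K // IsComplex w}, ∀ v ∈ V, D A[w] v ∈ V)
    (hBV : ∀ w : {w : InfinitePlace K // IsComplex w}, ∀ v ∈ V, D B[w] v ∈ V) :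
    ∃ x : archGardingSpace hcpt τ, x ≠ 0 ∧ x ∈ V ∧
      (∀ w : {w : InfinitePlace K // IsReal w}, ∃ k : ℂ, D W[w] x = k • x) ∧
      (∀ w : {w : InfinitePlace K // IsComplex w}, ∃ m : ℂ, D T[w] x = m • x) ∧
      (∀ w : {w : InfinitePlace K // IsComplex w}, D A[w] x - Complex.I • D B[w] x = 0) := by
  obtain ⟨v₀, hv₀V, hv₀⟩ := hV0
  haveI : Nontrivial V := ⟨⟨⟨v₀, hv₀V⟩, 0, fun h => hv₀ (congrArg Subtype.val h)⟩⟩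
  have hRV : ∀ w : {w : InfinitePlace K // IsComplex w}, ∀ v ∈ V, (D A[w] - Complex.I • D B[w]) v ∈ V := fun w v hv => by
    rw [LinearMap.sub_apply, LinearMap.smul_apply]
    exact V.sub_mem (hAV w v hv) (V.smul_mem _ (hBV w v hv))
  -- the torus family `F` and the raising operators `Rv` on `V`
  obtain ⟨F, hF₁, hF₂⟩ : ∃ F : ({w : InfinitePlace K // IsReal w} ⊕ {w : InfinitePlace K // IsComplex w}) → Module.End ℂ V,
      (∀ w, F (Sum.inl w) = (D W[w]).restrict (hWV w)) ∧ ∀ w, F (Sum.inr w) = (D T[w]).restrict (hTV w) :=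
    ⟨fun i => Sum.elim (fun w => (D W[w]).restrict (hWV w)) (fun w => (D T[w]).restrict (hTV w)) i, fun w => rfl, fun w => rfl⟩
  obtain ⟨Rv, hRv⟩ : ∃ Rv : {w : InfinitePlace K // IsComplex w} → Module.End ℂ V,
      ∀ w, Rv w = (D A[w] - Complex.I • D B[w]).restrict (hRV w) := ⟨_, fun w => rfl⟩
  -- commutation relations on `V`
  have hFcomm : ∀ i j, Commute (F i) (F j) := by
    rintro (w | w) (w' | w')
    · rw [hF₁, hF₁]; exact LinearMap.restrict_commute (weylR_comm hτ w w') _ _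
    · rw [hF₁, hF₂]; exact LinearMap.restrict_commute (weylR_comm_torusC hτ w w') _ _
    · rw [hF₂, hF₁]; exact LinearMap.restrict_commute (weylR_comm_torusC hτ w' w).symm _ _
    · rw [hF₂, hF₂]; exact LinearMap.restrict_commute (torusC_comm hτ w w') _ _
  have hRF : ∀ w i, i ≠ Sum.inr w → Commute (Rv w) (F i) := by
    rintro w (w' | w') hi
    · rw [hRv, hF₁]; exact LinearMap.restrict_commute ((raising_comm hτ w).1 w') _ _
    · rw [hRv, hF₂]; exact LinearMap.restrict_commute ((raising_comm hτ w).2.1 w' (fun h => hi (by rw [h]))) _ _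
  have hRRv : ∀ w w', w' ≠ w → Commute (Rv w) (Rv w') := fun w w' h => by
    rw [hRv, hRv]; exact LinearMap.restrict_commute ((raising_comm hτ w).2.2 w' h) _ _
  have hTR : ∀ w, F (Sum.inr w) * Rv w = Rv w * F (Sum.inr w) + (2 * Complex.I) • Rv w := by
    intro w
    rw [hF₂, hRv]
    refine LinearMap.ext fun v => Subtype.ext ?_
    have h := congrArg (fun T => T (v : archGardingSpace hcpt τ)) (torusC_mul_raising hτ w)
    simpa only [Module.End.mul_apply, LinearMap.add_apply, LinearMap.smul_apply, LinearMap.coe_restrict_apply,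
      Submodule.coe_add, Submodule.coe_smul] using h
  -- a common eigenvector of the torus family
  obtain ⟨x₀, hx₀, hx₀eig⟩ := Literature.LinearAlgebra.exists_ne_zero_forall_apply_eq_smul_of_commute F hFcomm
  -- minimise the number of complex places at which the vector is not highest
  let bad : V → ℕ := fun y => (Finset.univ.filter fun w => Rv w y ≠ 0).card
  have hex : ∃ m : ℕ, ∃ y : V, (y ≠ 0 ∧ ∀ i, ∃ a : ℂ, F i y = a • y) ∧ bad y = m := ⟨_, x₀, ⟨hx₀, hx₀eig⟩, rfl⟩
  obtain ⟨y, ⟨hy0, hyeig⟩, hym⟩ := Nat.find_spec hex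
  have hbad : ∀ w, Rv w y = 0 := by
    by_contra hne
    push Not at hne
    obtain ⟨w, hw⟩ := hne
    obtain ⟨a, ha⟩ := hyeig (Sum.inr w)
    obtain ⟨j, hj0, hj1, hjeig⟩ := exists_pow_apply_ne_zero_and_pow_succ_apply_eq_zero (F (Sum.inr w)) (Rv w)
      (mul_ne_zero two_ne_zero Complex.I_ne_zero) (hTR w) hy0 ha
    -- `y' = R^j y` is again a joint eigenvector
    have hy'eig : ∀ i, ∃ a : ℂ, F i ((Rv w ^ j) y) = a • (Rv w ^ j) y := by
      intro i
      by_cases hi : i = Sum.inr w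
      · subst hi; exact ⟨_, hjeig⟩
      · obtain ⟨b, hb⟩ := hyeig i
        refine ⟨b, ?_⟩
        rw [← Module.End.mul_apply, ← ((hRF w i hi).pow_left j).eq, Module.End.mul_apply, hb, map_smul]
    -- and is highest at strictly fewer places
    have hlt : bad ((Rv w ^ j) y) < bad y := by
      have hsub : (Finset.univ.filter fun w' => Rv w' ((Rv w ^ j) y) ≠ 0) ⊆
          (Finset.univ.filter fun w' => Rv w' y ≠ 0).erase w := by
        intro w' hw'
        rw [Finset.mem_filter] at hw'
        rw [Finset.mem_erase, Finset.mem_filter]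
        have hne' : w' ≠ w := by
          rintro rfl
          apply hw'.2
          rw [← Module.End.mul_apply, ← pow_succ']
          exact hj1
        refine ⟨hne', Finset.mem_univ _, fun h0 => hw'.2 ?_⟩
        rw [← Module.End.mul_apply, ((hRRv w' w hne'.symm).pow_right j).eq, Module.End.mul_apply, h0, map_zero]
      calc bad ((Rv w ^ j) y) ≤ ((Finset.univ.filter fun w' => Rv w' y ≠ 0).erase w).card := Finset.card_le_card hsub
        _ < bad y := Finset.card_erase_lt_of_mem (by rw [Finset.mem_filter]; exact ⟨Finset.mem_univ _, hw⟩)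
    have hmin := Nat.find_min' hex ⟨(Rv w ^ j) y, ⟨hj0, hy'eig⟩, rfl⟩
    rw [hym] at hlt
    exact absurd hmin (not_le.2 hlt)
  -- read off the statement on `x = y`
  refine ⟨(y : archGardingSpace hcpt τ), fun h => hy0 (Subtype.ext h), y.2, fun w => ?_, fun w => ?_, fun w => ?_⟩
  · obtain ⟨a, ha⟩ := hyeig (Sum.inl w)
    rw [hF₁] at ha
    exact ⟨a, by simpa only [LinearMap.coe_restrict_apply, Submodule.coe_smul] using congrArg Subtype.val ha⟩
  · obtain ⟨a, ha⟩ := hyeig (Sum.inr w)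
    rw [hF₂] at ha
    exact ⟨a, by simpa only [LinearMap.coe_restrict_apply, Submodule.coe_smul] using congrArg Subtype.val ha⟩
  · have h := hbad w
    rw [hRv] at h
    have h' := congrArg Subtype.val h
    simpa only [LinearMap.coe_restrict_apply, LinearMap.sub_apply, LinearMap.smul_apply, Submodule.coe_zero] using h'

end Stable

/-! ### 2. The base vector -/

section Base

variable {hcpt : isCompact_glFiniteIntegralLevel 2 K}
  {E : Type*} [NormedAddCommGroup E] [InnerProductSpace ℂ E] [CompleteSpace E]
  {τ : ContRepresentation ℂ (AutomorphyDatum.gl 2 K hcpt).arch.carrier E}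
  (hτ : τ.IsStronglyContinuous)

local notation "D" => gardingEnd (hcpt := hcpt) (τ := τ) hτ
local notation "W[" w "]" => (Matrix.single (0 : Fin 2) (1 : Fin 2) ((Pi.single w 1, 0) : mixedSpace K) -
  Matrix.single (1 : Fin 2) (0 : Fin 2) ((Pi.single w 1, 0) : mixedSpace K))
local notation "T[" w "]" => (Matrix.single (0 : Fin 2) (0 : Fin 2) ((0, Pi.single w Complex.I) : mixedSpace K) -
  Matrix.single (1 : Fin 2) (1 : Fin 2) ((0, Pi.single w Complex.I) : mixedSpace K))
local notation "A[" w "]" => (Matrix.single (0 : Fin 2) (1 : Fin 2) ((0, Pi.single w 1) : mixedSpace K) -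
  Matrix.single (1 : Fin 2) (0 : Fin 2) ((0, Pi.single w 1) : mixedSpace K))
local notation "B[" w "]" => (Matrix.single (0 : Fin 2) (1 : Fin 2) ((0, Pi.single w Complex.I) : mixedSpace K) +
  Matrix.single (1 : Fin 2) (0 : Fin 2) ((0, Pi.single w Complex.I) : mixedSpace K))
local notation "Flo[" w "]" => ((gardingEnd (hcpt := hcpt) (τ := τ) hτ (Matrix.single (1 : Fin 2) (0 : Fin 2) ((0, Pi.single w 1) : mixedSpace K)) -
    Complex.I • gardingEnd (hcpt := hcpt) (τ := τ) hτ (Matrix.single (1 : Fin 2) (0 : Fin 2) ((0, Pi.single w Complex.I) : mixedSpace K))) -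
  (gardingEnd (hcpt := hcpt) (τ := τ) hτ (Matrix.single (0 : Fin 2) (1 : Fin 2) ((0, Pi.single w 1) : mixedSpace K)) +
    Complex.I • gardingEnd (hcpt := hcpt) (τ := τ) hτ (Matrix.single (0 : Fin 2) (1 : Fin 2) ((0, Pi.single w Complex.I) : mixedSpace K))))

/-- The raising operator `τ(A_w) - iτ(B_w)` is `τ^h(E₀₁) - τ^a(E₁₀)` (regrouping). [folklore] -/
theorem raising_eq_hol_sub_anti (w : {w : InfinitePlace K // IsComplex w}) (x : archGardingSpace hcpt τ) :
    D A[w] x - Complex.I • D B[w] x =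
      ((D (Matrix.single 0 1 ((0, Pi.single w 1) : mixedSpace K)) - Complex.I • D (Matrix.single 0 1 ((0, Pi.single w Complex.I) : mixedSpace K))) -
        (D (Matrix.single 1 0 ((0, Pi.single w 1) : mixedSpace K)) + Complex.I • D (Matrix.single 1 0 ((0, Pi.single w Complex.I) : mixedSpace K)))) x := by
  rw [gardingEnd_sub, gardingEnd_add]
  simp only [LinearMap.sub_apply, LinearMap.add_apply, LinearMap.smul_apply, smul_add]
  abel

/-- **The base vector of the archimedean Hecke test vector** (Jacquet–Langlands (1970), §5–§6): for an
irreducible unitary `τ` and a non-zero continuous `ψ_∞`-Whittaker functional `ℓ` there is a Gårding vector `x`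
in a finite-dimensional `K_∞`-stable `V ⊆ 𝒢`, NOT in the null space `S_ℓ` of the Kirillov map, which is a
joint weight vector with integral weights — `τ(W_w) x = ik_w x`, `k_w ∈ ℤ`, at the real places; `τ(T_w) x = im_w x`,
`m_w ∈ ℕ`, highest (`E_w x = 0`) with `F_w^{m_w+1} x = 0 ≠ F_w^j x` (`j ≤ m_w`) at the complex places.
[cite: JacquetLanglands1970, §5 (Thm. 5.13), §6 (Thm. 6.4)] -/
theorem exists_baseVector (hτu : τ.IsUnitary) (hτi : τ.IsTopIrreducible)
    {ℓ : archGardingSpace hcpt τ →ₗ[ℂ] ℂ} (hℓW : IsArchContWhittakerFunctional hcpt τ hτ ℓ) (hne : ℓ ≠ 0) :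
    ∃ (V : Submodule ℂ (archGardingSpace hcpt τ)) (_ : FiniteDimensional ℂ V)
      (_ : ∀ κ ∈ Kinf 2 K, ∀ v ∈ V, gardingAct hτ κ v ∈ V) (x : archGardingSpace hcpt τ),
      x ∈ V ∧ x ∉ kirillovNull hτ ℓ ∧
      (∀ w : {w : InfinitePlace K // IsReal w}, ∃ k : ℤ, D W[w] x = (Complex.I * k) • x) ∧
      (∀ w : {w : InfinitePlace K // IsComplex w}, ∃ m : ℕ, D T[w] x = (Complex.I * m) • x ∧
        D A[w] x - Complex.I • D B[w] x = 0 ∧ (Flo[w] ^ (m + 1)) x = 0 ∧ ∀ j ≤ m, (Flo[w] ^ j) x ≠ 0) := by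
  obtain ⟨sW, sT, sA, sB⟩ := star_letters (K := K)
  -- a `K_∞`-finite Gårding `e` with `ℓ e ≠ 0` and the span `V` of its `K_∞`-translates
  obtain ⟨e, he, hfin⟩ := exists_kFinite_apply_ne_zero hℓW hτu hne
  set V : Submodule ℂ (archGardingSpace hcpt τ) :=
    Submodule.span ℂ (Set.range fun κ : Kinf 2 K => gardingAct hτ (κ : GL (Fin 2) (mixedSpace K)) e) with hVdef
  haveI hVfd : FiniteDimensional ℂ V := finiteDimensional_span_gardingAct hτ e hfin
  have hK : ∀ κ ∈ Kinf 2 K, ∀ v ∈ V, gardingAct hτ κ v ∈ V := fun κ hκ v hv => gardingAct_mem_span_of_mem hτ e hκ hv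
  have heV : e ∈ V := Submodule.subset_span ⟨⟨1, one_mem _⟩, by
    change gardingAct hτ (1 : GL (Fin 2) (mixedSpace K)) e = e
    rw [gardingAct_one]; rfl⟩
  have heS : e ∉ kirillovNull hτ ℓ := fun h => he (apply_eq_zero_of_mem_kirillovNull hτ ℓ h)
  -- `U = S_ℓ ∩ V`, its image in `E`, and `V₁ = V ∩ U^⊥`
  set U : Submodule ℂ (archGardingSpace hcpt τ) := kirillovNull hτ ℓ ⊓ V with hUdef
  set UE : Submodule ℂ E := U.map (archGardingSpace hcpt τ).subtype with hUE
  haveI : FiniteDimensional ℂ U := Submodule.finiteDimensional_of_le inf_le_right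
  haveI : FiniteDimensional ℂ UE := inferInstance
  haveI : CompleteSpace UE := (Submodule.closed_of_finiteDimensional UE).completeSpace_coe
  set V₁ : Submodule ℂ (archGardingSpace hcpt τ) := V ⊓ UEᗮ.comap (archGardingSpace hcpt τ).subtype with hV₁
  haveI : FiniteDimensional ℂ V₁ := Submodule.finiteDimensional_of_le inf_le_left
  have hmemV₁ : ∀ v : archGardingSpace hcpt τ, v ∈ V₁ ↔ v ∈ V ∧ ∀ u ∈ U, ⟪(u : E), (v : E)⟫_ℂ = 0 := by
    intro v
    rw [hV₁, Submodule.mem_inf, Submodule.mem_comap, Submodule.mem_orthogonal]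
    refine and_congr_right fun _ => ⟨fun h u hu => h _ ⟨u, hu, rfl⟩, fun h y hy => ?_⟩
    obtain ⟨u, hu, rfl⟩ := hy
    exact h u hu
  -- `S_ℓ` and hence `U` are stable under the letters
  have hSU : ∀ (X : Matrix (Fin 2) (Fin 2) (mixedSpace K)), star X = -X → ∀ u ∈ U, D X u ∈ U := fun X hX u hu =>
    ⟨gardingEnd_mem_kirillovNull_of_isUnitary hτ hτu hτi hℓW X hu.1, gardingEnd_mem_of_kStable hτ hK hX hu.2⟩
  have hV₁X : ∀ (X : Matrix (Fin 2) (Fin 2) (mixedSpace K)), star X = -X → ∀ v ∈ V₁, D X v ∈ V₁ := by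
    intro X hX v hv
    rw [hmemV₁] at hv ⊢
    exact gardingEnd_mem_orthogonal hτ hτu (fun v hv => gardingEnd_mem_of_kStable hτ hK hX hv) (hSU X hX) hv.1 hv.2
  -- `V₁ ≠ 0`: `e - P_U e`
  have hV₁0 : ∃ v ∈ V₁, v ≠ 0 := by
    obtain ⟨q, hqU, hqp⟩ := Submodule.mem_map.mp (UE.starProjection_apply_mem (e : E))
    refine ⟨e - q, (hmemV₁ _).2 ⟨V.sub_mem heV hqU.2, fun u hu => ?_⟩, fun h0 => heS ?_⟩
    · have horth := UE.sub_starProjection_mem_orthogonal (e : E)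
      rw [← hqp] at horth
      rw [Submodule.coe_sub]
      exact Submodule.inner_right_of_mem_orthogonal (K := UE) ⟨u, hu, rfl⟩ horth
    · rw [sub_eq_zero] at h0
      rw [h0]; exact hqU.1
  -- the joint weight vector in `V₁`
  obtain ⟨x, hx0, hxV₁, hxW, hxT, hxR⟩ := exists_jointWeightVector_highest_of_stable hτ hV₁0
    (fun w v hv => hV₁X _ (sW w) v hv) (fun w v hv => hV₁X _ (sT w) v hv) (fun w v hv => hV₁X _ (sA w) v hv)
    (fun w v hv => hV₁X _ (sB w) v hv)
  have hxV : x ∈ V := ((hmemV₁ x).1 hxV₁).1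
  have hxS : x ∉ kirillovNull hτ ℓ := by
    intro hxS
    have h := ((hmemV₁ x).1 hxV₁).2 x ⟨hxS, hxV⟩
    exact hx0 (Subtype.ext (inner_self_eq_zero.1 h))
  refine ⟨V, hVfd, hK, x, hxV, hxS, fun w => ?_, fun w => ?_⟩
  · obtain ⟨k, hk⟩ := hxW w
    obtain ⟨k', rfl⟩ := exists_int_weylR hτ w hx0 hk
    exact ⟨k', hk⟩
  · obtain ⟨c, hc⟩ := hxT w
    have hE : ((D (Matrix.single 0 1 ((0, Pi.single w 1) : mixedSpace K)) - Complex.I • D (Matrix.single 0 1 ((0, Pi.single w Complex.I) : mixedSpace K))) -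
        (D (Matrix.single 1 0 ((0, Pi.single w 1) : mixedSpace K)) + Complex.I • D (Matrix.single 1 0 ((0, Pi.single w Complex.I) : mixedSpace K)))) x = 0 := by
      rw [← raising_eq_hol_sub_anti hτ w x]; exact hxR w
    obtain ⟨m, rfl, hF1, hF0⟩ := exists_nat_weight_of_highest hτ w hK hxV hx0 hE hc
    exact ⟨m, hc, hxR w, hF1, hF0⟩

end Base

end Literature.NumberTheory.Automorphic
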